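import Summits.QuantumFields.BalabanUV.Beta.GAN24.GaugeTermKernelCubic
import Summits.QuantumFields.BalabanUV.Beta.GAN24.Entry110Rect
import Summits.QuantumFields.BalabanUV.Beta.GAN24.Entry110LapReduction

/-!
# G-an2-4 ∕ (CONV-C) — THE GAUGE-TERM KERNEL BOUND ON EVERY TORUS: binder (K) of `Entry110LapReduction.entry110Lap_one_of_kernel_decay`
# DISCHARGED (∀ `M`), by descending FILE B's cubic bound along leaf-02's covering bridge

G-an2-4 formalisation swarm `b2b-balaban-gan24-formalise-*`, leaf prover 01 (gen 56), crux team (2) under the coordinator ruling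
«YM REDIRECT» (e34b3e0c).  INTENT «DPD-LIT» (journal l.30179), FILE C.  FILE B (`GaugeTermKernelCubic`) bounds the counting-measure
entries of the typed gauge term `GradOp·PcT n M n·GradOpᴴ` by `C·n^{−(d+1)}·e^{−δ|blk x − blk x″|}` on CUBIC tori.  Every torus
`M : Fin (d+1) → ℕ` is covered by the cubic torus of side `Π_μ M_μ` (`Entry110Rect.dvd_prod_cover`), and leaf-02-g42's bridge
(`TorusCoveringOps`: `GradOp_mul_pull`, `PcT_mul_pull`, `GradOpH_mul_pullV`; `TorusCoveringRowSum`: `norm_kernel_le_fibre_sum`,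
`block_row_bound_transfer`; `TorusCoveringDeckSum.deck_sum_le`) says the base kernel is the FIBRE SUM of the cover kernel.  THIS FILE:
 * §1 `gaugeTerm_mul_pullV` — the gauge term intertwines with the pull-back (composition of the three tree intertwinings);
 * §2 the fine fibre over a site injects into the coarse fibre over its block (`blockOf` on the fibre, `cov_bpt`), so an ENTRY of the base
   kernel is at most `C·n^{−(d+1)}·Σ_{deck} e^{−δ|…|} ≤ C·periodConst δ d·n^{−(d+1)}·e^{−(δ∕(d+1))|…|}` — **`gaugeTerm_kernel_torus`**, and
   in the `bpt ∕ toT` currency **`gaugeTerm_kernel_torus_bpt`** = binder (K) of p253408 VERBATIM (every torus, every `n ≥ 1`);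
 * §3 by-name consequences: an `example : Entry110Lap d 1 := entry110Lap_one_of_kernel_decay d (gaugeTerm_kernel_torus_bpt d)` (a second,
   independent route to (E4); the tree theorem of record is `Entry110Rect.entry110Lap_one`, not restated), `gaugeTerm_rowDecay_torus`
   (road P2's `RowDecay` currency on every torus, via `block_row_bound_transfer`) and the sup → sup letter `gaugeTerm_sup_torus`.

HONEST SCOPE.  `U = 1`; EVERY torus, every `n ≥ 1`; constants existential in `d`; RATE DEGRADATION `δ ↦ δ∕(d+1)`, constant `× periodConst δ d`
(the deck sum) — no claim that a printed rate survives.  OUR estimate, [folklore]-grade; [B5] `Balaban1984PropagatorsI` p. 38 (1.126) is a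
TEXT LOCATION (pv15's `B5DPD126Uniform` = the multiplier MODEL; this = the LITERAL `B5Value126.PcT`).  No `def`, no `def … : Prop`, no
`sorry`.  Discharges no binder of (CONV-C) as typed; NOT (CONV-C), NEVER «G-an2-4 closed», NOT NE2 ∕ NE3, NOT D1, NOT BetaPertH, NOT
continuum, NOT Clay; not in print — our bookkeeping.  ABSOLUTE RULE of the cell kept.
HONEST DEPENDENCY: continuum YM on T⁴ ⇐ BetaPertH ∧ nine spine estimates (0/9 proved); BetaPertH ⇐ (D1) ∧ (D4) ∧ CAP+tail; G-an2-4
gates asym, D1 and NE2/3/4.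
-/

noncomputable section

open scoped BigOperators ComplexConjugate Matrix
open Finset

namespace Summit.QuantumFields.BalabanUV.Beta.GAN24.GaugeTermKernelTorus

open Literature.MathematicalPhysics.QuantumFieldTheory.Balaban1983to89
open B5Prop11Plancherel (Tor fine)
open B5Action121 (GradOp)
open B5Block118 (bpt QsOp)
open B5Blocks16 (blockOf blockOf_bpt bpt_bijective bpt_injective)
open B5Value126 (PcT)
open B4TorusKernel (periodConst)
open B4TorusKernel.MultiPeriod (torusSupNorm torusSupNorm_nonneg)
open B5Kernel166Decay (periodConst_pos)
open B4Sect5Proof (latticeConst latticeConst_nonneg)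
open B6LowerBound2153Torus (toT rep toT_rep)
open B5Prop12Entries110 (Entry110Lap)
open Summit.QuantumFields.BalabanUV.Beta.GAN24.BlockFieldDecay (RowDecay)
open Summit.QuantumFields.BalabanUV.Beta.GAN24.TorusCovering (cov pull pullV hfine cov_surjective cov_bpt blockOf_cov exists_rep_eq_translate)
open Summit.QuantumFields.BalabanUV.Beta.GAN24.TorusCoveringOps (itw_mul GradOp_mul_pull GradOpH_mul_pullV PcT_mul_pull)
open Summit.QuantumFields.BalabanUV.Beta.GAN24.TorusCoveringRowSum (norm_kernel_le_fibre_sum block_row_bound_transfer torusSupNorm_translate_sub)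
open Summit.QuantumFields.BalabanUV.Beta.GAN24.TorusCoveringDeckSum (deck_sum_le)
open Summit.QuantumFields.BalabanUV.Beta.GAN24.Entry110Rect (dvd_prod_cover prod_neZero)
open Summit.QuantumFields.BalabanUV.Beta.GAN24.Entry110GradCubic (torusSupNorm_rep_toT_sub_rep_toT)
open Summit.QuantumFields.BalabanUV.Beta.GAN24.SavgInverseUniform (latticeConst_pos_of_pos)
open Summit.QuantumFields.BalabanUV.Beta.GAN24.GaugeTermKernelCubic (gaugeTerm_kernel_cubic gaugeTerm_rowDecay_cubic
  norm_mulVec_le_of_rowDecay')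
open Summit.QuantumFields.BalabanUV.Beta.GAN24.Entry110LapReduction (entry110Lap_one_of_kernel_decay)

variable {d : ℕ}

/-! ## §1 The gauge term intertwines with the pull-back along a covering -/

section Intertwine

variable (n : ℕ) [NeZero n] {M M' : Fin (d + 1) → ℕ} [hM : ∀ μ, NeZero (M μ)] [hM' : ∀ μ, NeZero (M' μ)] (h : ∀ μ, M μ ∣ M' μ)

/-- **`(∂·P·∂ᴴ)(M′) * pullV = pullV * (∂·P·∂ᴴ)(M)`** — composition of `GradOp_mul_pull`, `PcT_mul_pull`, `GradOpH_mul_pullV`. [folklore] -/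
theorem gaugeTerm_mul_pullV :
    GradOp (fine n M') (n : ℂ) * PcT n M' (n : ℂ) * (GradOp (fine n M') (n : ℂ))ᴴ * pullV (hfine n h)
      = pullV (hfine n h) * (GradOp (fine n M) (n : ℂ) * PcT n M (n : ℂ) * (GradOp (fine n M) (n : ℂ))ᴴ) := by
  have hn : (n : ℂ) ≠ 0 := Nat.cast_ne_zero.mpr (NeZero.ne n)
  have h1 := itw_mul (PcT_mul_pull n h hn) (GradOpH_mul_pullV (hfine n h) (n : ℂ))
  have h2 := itw_mul (GradOp_mul_pull (hfine n h) (n : ℂ)) h1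
  simpa only [Matrix.mul_assoc] using h2

end Intertwine

/-! ## §2 Entries descend along the covering: the fine fibre over a site injects into the coarse fibre over its block -/

section Fibre

variable (n : ℕ) [NeZero n] {M M' : Fin (d + 1) → ℕ} [hM : ∀ μ, NeZero (M μ)] [hM' : ∀ μ, NeZero (M' μ)] (h : ∀ μ, M μ ∣ M' μ)

/-- `blockOf` is injective on a fine fibre: two fine sites over the same base site with the same block coincide
(`x̃ = bpt (blockOf x̃) j`, `cov (bpt ỹ j) = bpt (cov ỹ) j`, `bpt` injective). [folklore] -/
theorem blockOf_injOn_fibre (x : Tor (fine n M)) {a b : Tor (fine n M')} (ha : cov (hfine n h) a = x) (hb : cov (hfine n h) b = x)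
    (hab : blockOf n M' a = blockOf n M' b) : a = b := by
  obtain ⟨ja, hja⟩ := SavgEntryDecay.exists_eq_bpt_blockOf n M' a
  obtain ⟨jb, hjb⟩ := SavgEntryDecay.exists_eq_bpt_blockOf n M' b
  have hca : cov (hfine n h) a = bpt n M (cov h (blockOf n M' a)) ja := by
    conv_lhs => rw [hja]
    rw [cov_bpt]
  have hcb : cov (hfine n h) b = bpt n M (cov h (blockOf n M' b)) jb := by
    conv_lhs => rw [hjb]
    rw [cov_bpt]
  have e : bpt n M (cov h (blockOf n M' a)) ja = bpt n M (cov h (blockOf n M' b)) jb := by rw [← hca, ← hcb, ha, hb]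
  have hj : ja = jb := by
    have := bpt_injective n M (a₁ := (cov h (blockOf n M' a), ja)) (a₂ := (cov h (blockOf n M' b), jb)) e
    exact (Prod.mk.inj this).2
  rw [hja, hjb, hab, hj]

/-- **an ENTRY bound descends**: if the cover kernel has entries `≤ c·e^{−δ|blk ĩ − blk x̃|}` then the base kernel has entries
`≤ c·periodConst δ d·e^{−(δ∕(d+1))|blk i − blk x|}` (fibre sum `norm_kernel_le_fibre_sum`, injection of the fine fibre into the coarse deck,
`deck_sum_le`). [folklore] -/
theorem norm_apply_le_of_cover
    {K' : Matrix (Tor (fine n M') × Fin (d + 1)) (Tor (fine n M') × Fin (d + 1)) ℂ}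
    {K : Matrix (Tor (fine n M) × Fin (d + 1)) (Tor (fine n M) × Fin (d + 1)) ℂ}
    (hK : K' * pullV (hfine n h) = pullV (hfine n h) * K) {c δ : ℝ} (hc : 0 ≤ c) (hδ : 0 < δ)
    (hK' : ∀ (μ ν : Fin (d + 1)) (x' x'' : Tor (fine n M')),
      ‖K' (x', μ) (x'', ν)‖ ≤ c * Real.exp (-(δ * torusSupNorm M' (rep M' (blockOf n M' x') - rep M' (blockOf n M' x'')))))
    (μ ν : Fin (d + 1)) (x x'' : Tor (fine n M)) :
    ‖K (x, μ) (x'', ν)‖ ≤ c * periodConst δ d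
      * Real.exp (-(δ / (d + 1) * torusSupNorm M (rep M (blockOf n M x) - rep M (blockOf n M x'')))) := by
  obtain ⟨x', hx'⟩ := cov_surjective (hfine n h) x
  have hfib := norm_kernel_le_fibre_sum (hfine n h) hK (x', μ) (x'', ν)
  rw [hx'] at hfib
  -- bound each fibre term and pass to the coarse deck
  set F : Finset (Tor (fine n M')) := Finset.univ.filter (fun y' => cov (hfine n h) y' = x'') with hF
  have h1 : ∑ y' : Tor (fine n M'), (if cov (hfine n h) y' = x'' then ‖K' (x', μ) (y', ν)‖ else 0)
      ≤ ∑ y' ∈ F, c * Real.exp (-(δ * torusSupNorm M' (rep M' (blockOf n M' x') - rep M' (blockOf n M' y')))) := by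
    rw [← Finset.sum_filter]
    exact Finset.sum_le_sum fun y' _ => hK' μ ν x' y'
  -- the fine fibre injects into the coarse fibre under `blockOf`
  have hinj : Set.InjOn (blockOf n M') (F : Set (Tor (fine n M'))) := by
    intro a ha b hb hab
    have ha' : cov (hfine n h) a = x'' := by simpa [hF] using ha
    have hb' : cov (hfine n h) b = x'' := by simpa [hF] using hb
    exact blockOf_injOn_fibre n h x'' ha' hb' hab
  have himg : F.image (blockOf n M') ⊆ Finset.univ.filter (fun z' : Tor M' => cov h z' = blockOf n M x'') := by
    intro z hz
    obtain ⟨y', hy', rfl⟩ := Finset.mem_image.mp hz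
    have hy'' : cov (hfine n h) y' = x'' := by simpa [hF] using hy'
    simp only [Finset.mem_filter, Finset.mem_univ, true_and]
    rw [← blockOf_cov n h y', hy'']
  have h2 : ∑ y' ∈ F, c * Real.exp (-(δ * torusSupNorm M' (rep M' (blockOf n M' x') - rep M' (blockOf n M' y'))))
      = ∑ z' ∈ F.image (blockOf n M'), c * Real.exp (-(δ * torusSupNorm M' (rep M' (blockOf n M' x') - rep M' z'))) := by
    rw [Finset.sum_image hinj]
  have h3 : ∑ z' ∈ F.image (blockOf n M'), c * Real.exp (-(δ * torusSupNorm M' (rep M' (blockOf n M' x') - rep M' z')))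
      ≤ ∑ z' ∈ Finset.univ.filter (fun z' : Tor M' => cov h z' = blockOf n M x''),
          c * Real.exp (-(δ * torusSupNorm M' (rep M' (blockOf n M' x') - rep M' z'))) :=
    Finset.sum_le_sum_of_subset_of_nonneg himg fun _ _ _ => by positivity
  have h4 := deck_sum_le h hδ (rep M' (blockOf n M' x')) (blockOf n M x'')
  -- `rep M′ (blockOf x′)` projects to `rep M (blockOf x)` modulo `M`: the deck lemma is stated for an arbitrary integer point `t`,
  -- and `torusSupNorm M` only sees `t` through the base torus
  have h5 : torusSupNorm M (rep M' (blockOf n M' x') - rep M (blockOf n M x''))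
      = torusSupNorm M (rep M (blockOf n M x) - rep M (blockOf n M x'')) := by
    obtain ⟨m, hm⟩ := exists_rep_eq_translate h (blockOf n M' x')
    rw [hm, torusSupNorm_translate_sub, ← blockOf_cov n h, hx']
  calc ‖K (x, μ) (x'', ν)‖ ≤ _ := hfib
    _ ≤ _ := h1
    _ = _ := h2
    _ ≤ _ := h3
    _ = c * ∑ z' ∈ Finset.univ.filter (fun z' : Tor M' => cov h z' = blockOf n M x''),
          Real.exp (-(δ * torusSupNorm M' (rep M' (blockOf n M' x') - rep M' z'))) := by rw [Finset.mul_sum]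
    _ ≤ c * (periodConst δ d * Real.exp (-(δ / (d + 1) * torusSupNorm M (rep M' (blockOf n M' x') - rep M (blockOf n M x''))))) :=
        mul_le_mul_of_nonneg_left h4 hc
    _ = _ := by rw [h5]; ring

end Fibre

/-! ## §3 ENDs on every torus; (K) discharged; (E4) a second time BY NAME; road P2's currencies -/

section End

variable (d)

/-- **END — THE GAUGE-TERM KERNEL ON EVERY TORUS, UNIFORMLY IN `n`**: there are `δ, C > 0` (depending on `d` only) such that for every
`n ≥ 1`, EVERY torus `M : Fin (d+1) → ℕ`, all `μ ν x x″`,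
`‖(GradOp·PcT n M n·GradOpᴴ)((x,μ),(x″,ν))‖ ≤ C·n^{−(d+1)}·e^{−δ·|rep(blk x) − rep(blk x″)|_{T,∞}}` — FILE B's cubic bound at the cubic cover
`Π_μ M_μ`, descended along the covering (`δ = δ_cubic∕(d+1)`, `C = C_cubic·periodConst δ_cubic d`). [folklore] -/
theorem gaugeTerm_kernel_torus :
    ∃ δ C : ℝ, 0 < δ ∧ 0 < C ∧ ∀ (n : ℕ) (M : Fin (d + 1) → ℕ) [NeZero n] [∀ μ, NeZero (M μ)], 1 ≤ n →
      ∀ (μ ν : Fin (d + 1)) (x x'' : Tor (fine n M)),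
        ‖(GradOp (fine n M) (n : ℂ) * PcT n M (n : ℂ) * (GradOp (fine n M) (n : ℂ))ᴴ) (x, μ) (x'', ν)‖
          ≤ C / (n : ℝ) ^ (d + 1)
            * Real.exp (-(δ * torusSupNorm M (rep M (blockOf n M x) - rep M (blockOf n M x'')))) := by
  obtain ⟨δ, C, hδ, hC, h⟩ := gaugeTerm_kernel_cubic d
  refine ⟨δ / (d + 1), C * periodConst δ d, div_pos hδ (by positivity), mul_pos hC (periodConst_pos hδ d), ?_⟩
  intro n M _ _ hn μ ν x x''
  haveI := prod_neZero M
  have hnr : (0 : ℝ) < (n : ℝ) ^ (d + 1) := pow_pos (Nat.cast_pos.mpr (NeZero.pos n)) _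
  have hcub := h n (∏ κ, M κ) hn
  have hdesc := norm_apply_le_of_cover n (dvd_prod_cover M) (gaugeTerm_mul_pullV n (dvd_prod_cover M))
    (c := C / (n : ℝ) ^ (d + 1)) (by positivity) hδ hcub μ ν x x''
  calc _ ≤ _ := hdesc
    _ = _ := by ring

/-- **BINDER (K) OF `Entry110LapReduction.entry110Lap_one_of_kernel_decay` (p253408) DISCHARGED — VERBATIM, EVERY TORUS**: the
(1.126)-shape entry decay of the LITERAL `GradOp·PcT·GradOpᴴ` in the `bpt ∕ toT` currency. [folklore] -/
theorem gaugeTerm_kernel_torus_bpt :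
    ∃ δ C : ℝ, 0 < δ ∧ 0 < C ∧
      ∀ (n : ℕ) (M : Fin (d + 1) → ℕ) [NeZero n] [∀ μ, NeZero (M μ)], 1 ≤ n →
        ∀ (y y'' : Fin (d + 1) → ℤ) (r r'' : Fin (d + 1) → Fin n) (μ ν : Fin (d + 1)),
          ‖(GradOp (fine n M) (n : ℂ) * PcT n M (n : ℂ) * (GradOp (fine n M) (n : ℂ))ᴴ)
              (bpt n M (toT M y) r, μ) (bpt n M (toT M y'') r'', ν)‖
            ≤ C / (n : ℝ) ^ (d + 1) * Real.exp (-(δ * torusSupNorm M (y - y''))) := by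
  obtain ⟨δ, C, hδ, hC, h⟩ := gaugeTerm_kernel_torus d
  refine ⟨δ, C, hδ, hC, fun n M _ _ hn y y'' r r'' μ ν => ?_⟩
  have h1 := h n M hn μ ν (bpt n M (toT M y) r) (bpt n M (toT M y'') r'')
  rwa [blockOf_bpt, blockOf_bpt, torusSupNorm_rep_toT_sub_rep_toT] at h1

/-- SHAPE CERTIFICATE (an `example`, not a declaration — the statement `Entry110Lap d 1` is ALREADY the tree theorem
`Entry110Rect.entry110Lap_one`, leaf-02-g42, via the flat carrier): leaf-01-g54's conditional reduction
`Entry110LapReduction.entry110Lap_one_of_kernel_decay` APPLIED to (K) = `gaugeTerm_kernel_torus_bpt` elaborates — a second, independent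
route to (E4) at `a = 1` on every torus (pv15's entry 1 + the literal (1.126) bound).  Text location: [B5] `Balaban1984PropagatorsI`
Prop. 1.2 (1.110) p. 35; the typed inequality is ours. [folklore] -/
example : Entry110Lap d 1 :=
  entry110Lap_one_of_kernel_decay d (gaugeTerm_kernel_torus_bpt d)

/-- **road P2's `RowDecay` currency on EVERY torus** (FILE B's cubic `gaugeTerm_rowDecay_cubic` transferred by
`TorusCoveringRowSum.block_row_bound_transfer`). [folklore] -/
theorem gaugeTerm_rowDecay_torus :
    ∃ C δ : ℝ, 0 < C ∧ 0 < δ ∧ ∀ (n : ℕ) (M : Fin (d + 1) → ℕ) [NeZero n] [∀ μ, NeZero (M μ)], 1 ≤ n →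
      RowDecay M (fun i : Tor (fine n M) × Fin (d + 1) => blockOf n M i.1) (fun i => blockOf n M i.1)
        (GradOp (fine n M) (n : ℂ) * PcT n M (n : ℂ) * (GradOp (fine n M) (n : ℂ))ᴴ) C δ := by
  obtain ⟨C, δ, hC, hδ, h⟩ := gaugeTerm_rowDecay_cubic d
  refine ⟨C * periodConst δ d, δ / (d + 1), mul_pos hC (periodConst_pos hδ d), div_pos hδ (by positivity), ?_⟩
  intro n M _ _ hn i y
  haveI := prod_neZero M
  have hcub := h n (∏ κ, M κ) hn
  exact block_row_bound_transfer n (dvd_prod_cover M) (gaugeTerm_mul_pullV n (dvd_prod_cover M)) hC.le hδ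
    (fun i' y' => hcub i' y') i y

/-- **the sup → sup letter of the gauge term on EVERY torus, n-UNIFORM**: `‖(∂P∂ᴴ J)(x,μ)‖ ≤ C·‖J‖_∞`, `C` depending on `d` only. [folklore] -/
theorem gaugeTerm_sup_torus :
    ∃ C : ℝ, 0 < C ∧ ∀ (n : ℕ) (M : Fin (d + 1) → ℕ) [NeZero n] [∀ μ, NeZero (M μ)], 1 ≤ n →
      ∀ (J : Tor (fine n M) × Fin (d + 1) → ℂ) (b : ℝ), (∀ j, ‖J j‖ ≤ b) →
        ∀ i, ‖((GradOp (fine n M) (n : ℂ) * PcT n M (n : ℂ) * (GradOp (fine n M) (n : ℂ))ᴴ) *ᵥ J) i‖ ≤ C * b := by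
  obtain ⟨C, δ, hC, hδ, h⟩ := gaugeTerm_rowDecay_torus d
  refine ⟨C * latticeConst (d + 1) δ, mul_pos hC (latticeConst_pos_of_pos (Nat.succ_pos d) hδ), ?_⟩
  intro n M _ _ hn J b hJ i
  exact norm_mulVec_le_of_rowDecay' n M _ hδ (h n M hn) J b hJ i

end End

end Summit.QuantumFields.BalabanUV.Beta.GAN24.GaugeTermKernelTorus

end
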